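import Literature.NumberTheory.Automorphic.WohlfahrtTheorem
import HarnessLib

/-!
# Type II character groups of `Γ₀(n)` not containing `Γ₁(n)` are noncongruence (Kurth–Long 2008, Prop. 18)

C. A. Kurth, L. Long, *On modular forms for some noncongruence subgroups of `SL₂(ℤ)`*, J. Number Theory
**128** (2008) 1989–2009, doi:10.1016/j.jnt.2007.10.007, §4 (p. 1997 of the journal; materialised text
`paper:doi-10-1016-j-jnt-2007-10-007` p. 8–9), verbatim:

> **Definition 16.** A homomorphism `ϕ : Γ⁰ → G` (`G` can be non-abelian) is said to be of type II if it
> sends all parabolic elements in `Γ⁰` to the identity of `G`.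
> **Proposition 18.** Let `ϕ` be a homomorphism of type II from `Γ⁰(n)` to another finite group (not
> necessarily abelian) whose kernel `Γ` does not contain `Γ¹(n)`. Then `Γ` is noncongruence.

(The printed proof: the level of `Γ` stays `n` since every parabolic of `Γ⁰(n)` lies in `Γ`; if `Γ` were
congruence, comparing cusp widths at `0` gives `[Γ ∩ Γ¹(n) : Γ(n)] ≥ n = [Γ¹(n) : Γ(n)]`, so `Γ¹(n) ⊆ Γ`.)

## Rendering

* Kurth–Long work with `Γ⁰(n)` / `Γ¹(n)` (upper-right entry `≡ 0`) inside `PSL₂(ℤ)`; conjugation by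
  `[0, 1; −1, 0]` carries `Γ⁰(n), Γ¹(n)` to Mathlib's `Gamma0 n`, `Gamma1 n`, and we state the result for
  subgroups `Γ ≤ SL(2, ℤ)`.  "Kernel of a homomorphism from `Γ₀(n)` to a finite group" is rendered as: `Γ`
  has finite index and is normalised by `Γ₀(n)`; "type II" is rendered by the (slightly STRONGER, hence
  harmless) hypothesis that every element of `Γ₀(n)` of trace `±2` — all `±`parabolics and `±1`, so in
  particular `Γ ∋ -1` is the full preimage of its image in `PSL₂(ℤ)` — lies in `Γ`; "noncongruence" is
  `¬ Γ(M) ≤ Γ` for every `M > 0`.  The Lean statement is therefore implied by the printed one.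
* It is also a THEOREM here: by Wohlfahrt's theorem (tree, `WohlfahrtTheorem.lean`,
  `Wohlfahrt.Gamma_le_of_isCongruenceSubgroup_of_forall_conj_T_pow_mem`) a congruence `Γ` containing every
  conjugate `g Tⁿ g⁻¹` (a trace-2 element of `Γ(n) ≤ Γ₀(n)`) contains `Γ(n)`, and with `T ∈ Γ` (trace 2,
  `T ∈ Γ₀(n)`) it contains `Γ(n)·⟨T⟩ = Γ₁(n)`.  Normality and finite index are not even needed for this
  direction; they are kept in the statement to match the printed hypotheses.

Consumer: cell `bsd-f2-manin`, C3 reducible residual, the UDC line of planner `-an` g37 (cite-shaped input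
`UDCKummerLine.TypeIINoncongruence` of `Summits/BirchSwinnertonDyer/Rank1Residual/ManinAdditive/UDCKummerLine.lean`,
whose body is literally the statement below).  No new definition, no named fact (D-0026).
-/

namespace Literature.NumberTheory.Automorphic

open scoped MatrixGroups
open CongruenceSubgroup Matrix.SpecialLinearGroup ModularGroup

/-- Entries of `γ * T ^ k` in `SL(2, ℤ)`: right multiplication by `T ^ k = [1, k; 0, 1]` adds `k` times the
first column to the second. [folklore] -/
private theorem mul_T_zpow_apply (γ : SL(2, ℤ)) (k : ℤ) :
    (γ * T ^ k) 0 0 = γ 0 0 ∧ (γ * T ^ k) 0 1 = γ 0 0 * k + γ 0 1 ∧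
      (γ * T ^ k) 1 0 = γ 1 0 ∧ (γ * T ^ k) 1 1 = γ 1 0 * k + γ 1 1 := by
  have h : (↑(γ * T ^ k) : Matrix (Fin 2) (Fin 2) ℤ) = (↑γ : Matrix (Fin 2) (Fin 2) ℤ) * !![1, k; 0, 1] := by
    rw [coe_mul, coe_T_zpow]
  refine ⟨?_, ?_, ?_, ?_⟩ <;>
  · rw [h]; simp [Matrix.mul_apply, Fin.sum_univ_two]

/-- The trace of a conjugate `g * T ^ N * g⁻¹` is `2`. [folklore] -/
private theorem trace_conj_T_pow (g : SL(2, ℤ)) (N : ℕ) :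
    (g * T ^ N * g⁻¹) 0 0 + (g * T ^ N * g⁻¹) 1 1 = 2 := by
  have htr : ∀ A : SL(2, ℤ), A 0 0 + A 1 1 = (↑A : Matrix (Fin 2) (Fin 2) ℤ).trace := fun A ↦ by
    simp [Matrix.trace, Fin.sum_univ_two]
  have hT : ((T ^ N : SL(2, ℤ)) : Matrix (Fin 2) (Fin 2) ℤ) = !![1, (N : ℤ); 0, 1] := by
    rw [← zpow_natCast, coe_T_zpow]
  rw [htr, coe_mul, coe_mul, Matrix.trace_mul_cycle, ← coe_mul, inv_mul_cancel,
    Matrix.SpecialLinearGroup.coe_one, Matrix.one_mul, hT]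
  simp [Matrix.trace, Fin.sum_univ_two]

/-- **Kurth–Long 2008, Proposition 18** (type II character groups of `Γ₀(n)` not containing `Γ₁(n)` are
noncongruence), in the `SL₂(ℤ)`/`Γ₀(n)` rendering described in the module docstring: a finite-index
subgroup `Γ ≤ Γ₀(n)`, normalised by `Γ₀(n)`, containing every element of `Γ₀(n)` of trace `±2`, and NOT
containing `Γ₁(n)`, contains no principal congruence subgroup `Γ(M)`, `M > 0`.  PROVED from Wohlfahrt's
theorem (tree): congruence + all parabolics ⟹ `Γ(n) ≤ Γ` ⟹ (with `T ∈ Γ`) `Γ₁(n) ≤ Γ`.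
[cite: KurthLong2008, Prop. 18 with Def. 16 (J. Number Theory 128 (2008), p. 1997)]
[cite: Wohlfahrt1964, Theorem 2 (the level theorem used in the printed proof)] -/
theorem KurthLong2008_prop18_typeII_noncongruence (n : ℕ) (_hn : 0 < n) (Γ : Subgroup SL(2, ℤ))
    (_hfi : Γ.FiniteIndex) (_hle : Γ ≤ Gamma0 n)
    (_hnorm : ∀ g ∈ Gamma0 n, ∀ γ ∈ Γ, g * γ * g⁻¹ ∈ Γ)
    (hII : ∀ γ ∈ Gamma0 n, (γ 0 0 + γ 1 1 = 2 ∨ γ 0 0 + γ 1 1 = -2) → γ ∈ Γ)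
    (h1 : ¬ (Gamma1 n ≤ Γ)) (M : ℕ) (hM : 0 < M) : ¬ (CongruenceSubgroup.Gamma M ≤ Γ) := by
  intro hΓM
  apply h1
  -- `Γ` is a congruence subgroup
  have hcong : IsCongruenceSubgroup Γ := ⟨M, hM.ne', hΓM⟩
  -- every conjugate of `T ^ n` lies in `Γ(n) ≤ Γ₀(n)` and has trace `2`, hence lies in `Γ`
  have hconj : ∀ g : SL(2, ℤ), g * T ^ n * g⁻¹ ∈ Γ := by
    intro g
    have hTn : T ^ n ∈ Gamma n := by
      have := ModularGroup_T_pow_mem_Gamma (n : ℤ) (n : ℤ) dvd_rfl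
      rwa [Int.natAbs_natCast, zpow_natCast] at this
    have hmem : g * T ^ n * g⁻¹ ∈ Gamma n := (Gamma_normal n).conj_mem _ hTn g
    have h0 : g * T ^ n * g⁻¹ ∈ Gamma0 n := by
      rw [Gamma0_mem]
      exact (Gamma_mem.mp hmem).2.2.1
    exact hII _ h0 (Or.inl (trace_conj_T_pow g n))
  -- Wohlfahrt: `Γ(n) ≤ Γ`
  have hΓn : Gamma n ≤ Γ := Wohlfahrt.Gamma_le_of_isCongruenceSubgroup_of_forall_conj_T_pow_mem hcong hconj
  -- `T ∈ Γ` (trace `2`, `T ∈ Γ₀(n)`)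
  have hT : T ∈ Γ := by
    refine hII T (by rw [Gamma0_mem]; simp [ModularGroup.T]) (Or.inl ?_)
    simp [ModularGroup.T]
  -- `Γ₁(n) = Γ(n) · ⟨T⟩ ≤ Γ`
  intro γ hγ
  obtain ⟨h00, h11, h10⟩ := (Gamma1_mem n γ).mp hγ
  set b : ℤ := γ 0 1 with hb
  have hprod : γ * T ^ (-b) ∈ Gamma n := by
    obtain ⟨e00, e01, e10, e11⟩ := mul_T_zpow_apply γ (-b)
    rw [Gamma_mem, e00, e01, e10, e11]
    refine ⟨h00, ?_, h10, ?_⟩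
    · push_cast; rw [h00]; ring
    · push_cast; rw [h10, h11]; ring
  have : γ = γ * T ^ (-b) * T ^ b := by rw [mul_assoc, ← zpow_add, neg_add_cancel, zpow_zero, mul_one]
  rw [this]
  exact mul_mem (hΓn hprod) (Subgroup.zpow_mem Γ hT b)

end Literature.NumberTheory.Automorphic
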